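import Literature.NumberTheory.Rogawski1990.ArchBouazizWallSetRepresentation     -- ★ (this seat) (S7a): `exists_wallSet_representation`, `sin_wallAngle_ne_zero_of_circleExp_ne`; brings ★ p850992, ★ (S2), ★ prelims, ★ p851151
import Mathlib.Analysis.Calculus.ContDiff.Bounds                                 -- `norm_iteratedFDerivWithin_mul_le`
import HarnessLib

/-!
# THE LOCAL JET BOUND OF `E_S · I` AT A BASE POINT, FROM THE `k`-FOLD ENGINE (stage (α4-S7b), part 1, of `ALPHA4-DESIGN.v1.md`: Bouaziz (I₂) for the model, all orders, general `fH`)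

Topic `NumberTheory/Rogawski1990`; namespace `Literature.NumberTheory.Rogawski1990`.  THEOREMS ONLY (no `def`, no instance, no axiom, no `sorry`).  Cell `pub/hodgecm-mathlib`,
crux H413 (`stmt-HodgeConjecture-24833`), line LH3 (closer stub `stub_N9`, DIRECT ROAD), organ O-L3′ conjunct (ii) pay-down for GENERAL `fH` (`h2` of ★ `archBzSmoothBounded_stOrbFamH_of_slab_zero`).
Author LH3-p01 (g5).  Count-neutral.

WHAT.  With the leaves of ★ p850992 fixed (`I(c) = ∫ fH(eA⁻¹(z_{w,1} γ_w(c) z_{w,2} z_{w,1}⁻¹)_w, b(c)) d(⊗Λ)`), and ASSUMING the conclusion of the `k`-fold Casimir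
engine for the wall sets of `S` (`hInv`: LH10-p01's `Inv ι` (α4-S6), frozen text v4, read at `ι := ↥P₀`, `wl := Subtype.val`, `z := 1`, `ν := ν_w|P₀` — JOINT jets of
`(ψ, v) ↦ (∏ 2 sin ψ_i) · ∫ Φ(v, (↑↑(h_i · P t_1(ψ_i) P⁻¹ · h_i⁻¹))_i) d(⊗ν)` bounded on the open signed unit cube times a compact, for every smooth slot `V`, Banach `E`, jointly smooth `Φ`
of one compact matrix support), EVERY JET OF `G₀ = E_S · I` IS BOUNDED NEAR EVERY POINT `c₁`, on `U ∩ InRegS S`: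
**`exists_nhds_forall_norm_iteratedFDeriv_expFactor_mul_le … (hInv) (c₁) (n) : ∃ U ∈ 𝓝 c₁, ∃ B, ∀ c ∈ U ∩ InRegS S, ‖iteratedFDeriv ℝ n (E_S · I) c‖ ≤ B`** (§3).
ROUTE.  `P₀ :=` the compact walls through `c₁`, `m_w` the slab shift with `ψ_w(c₁) = 0`; on a ball `U` around `c₁` (closure `C₁` regular at the compact places off `P₀`, `|ψ_w| < 1`):
`E_S = u · ∏_{P₀} 2 sin ψ_i` with a smooth `u` (§2, ★ `one_sub_circleExp_eq_two_sin_mul`), `I = ℓ(∫ g(c, Y(h, ψ(c))) d(⊗ν))` (★ (S7a) `exists_wallSet_representation`), hence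
`E_S · I = u · (ℓ ∘ F ∘ J)` on `U ∩ InRegS S`, `F` = the engine's joint functional for `Φ := g` (smooth off the walls: ★ `contDiffOn_torusFunctional`), `J c = (ψ(c), c)` affine;
Leibniz on the open set (Mathlib `norm_iteratedFDerivWithin_mul_le`), the jets of `ℓ ∘ F ∘ J` from those of `F` (§1: a continuous linear map on the left, an affine map on the right),
and `hInv` at `J c ∈ (signed open unit cube) × C₁`.
HONEST LABEL: HC_CM is proved only modulo the 7 printed citations (2 remaining: hLiu418 = stmt-HodgeConjecture-24832, h413 = stmt-HodgeConjecture-24833) until rung 0 closes; this bound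
is CONDITIONAL on `hInv` (the `k`-fold engine, LH10-p01, in flight) and pays nothing by itself.

## References
* [Varadarajan1989] V. S. Varadarajan, *An Introduction to Harmonic Analysis on Semisimple Lie Groups*, Cambridge Stud. Adv. Math. 16 (1989), §6.4 Thms 22–24.
* [Bouaziz1994IntegralesOrbitales] A. Bouaziz, *Intégrales orbitales sur les algèbres de Lie réductives*, Invent. Math. 115 (1994), §3.1 (I₂) p. 579; §6.2 p. 591.
* [Shelstad1979] D. Shelstad, *Characters and inner forms of a quasi-split group over ℝ*, Compositio Math. 39 (1979), §4 pp. 22–25.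
* [HormanderALPDO1] L. Hörmander, *The Analysis of Linear Partial Differential Operators I* (1990), §1.1 Thms. 1.1.6–1.1.9.
* [Rogawski1990] J. D. Rogawski, *Automorphic Representations of Unitary Groups in Three Variables*, Ann. of Math. Stud. 123 (1990), §8.2 pp. 119–122.
-/

set_option autoImplicit false

noncomputable section

open MeasureTheory Measure Filter Topology Set Function NumberField NumberField.InfinitePlace NumberField.mixedEmbedding Matrix Complex BoundedContinuousFunction
open Literature.NumberTheory.Automorphic Literature.NumberTheory.Automorphic.UnitaryGroup Literature.NumberTheory.Automorphic.ArchCartan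
open scoped ContDiff MatrixGroups Matrix Classical ENNReal NNReal
open scoped Matrix.Norms.Operator

namespace Literature.NumberTheory.Rogawski1990

local notation3 "Φ₂[" L "]" => (Matrix.of fun i j : Fin 2 => if i.val + j.val + 1 = 2 then (1 : L) else 0)
local notation3 "Φ₁[" L "]" => (Matrix.of fun i j : Fin 1 => if i.val + j.val + 1 = 1 then (1 : L) else 0)
local notation3 "𝔸[" L "]" => ↥(arch (↥(maximalRealSubfield L)) L (IsCMField.complexConj L) 2 Φ₂[L])
local notation3 "𝔹[" L "]" => ↥(arch (↥(maximalRealSubfield L)) L (IsCMField.complexConj L) 1 Φ₁[L])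

/-! ## §1 Three generic jet bounds on an open set: affine pull-back, continuous linear push-forward, product -/

section Generic

variable {X : Type*} [NormedAddCommGroup X] [NormedSpace ℝ X] {Y : Type*} [NormedAddCommGroup Y] [NormedSpace ℝ Y]
  {E : Type*} [NormedAddCommGroup E] [NormedSpace ℝ E] {F : Type*} [NormedAddCommGroup F] [NormedSpace ℝ F]

/-- **Jets of an affine pull-back**: for `f` `C^∞` on the open `s`, a continuous linear `A : X →L Y`, `a : Y` and `x` with `A x + a ∈ s`,
`‖iteratedFDeriv ℝ n (fun y => f (A y + a)) x‖ ≤ ‖A‖ⁿ · ‖iteratedFDeriv ℝ n f (A x + a)‖` (Mathlib `ContinuousLinearMap.iteratedFDerivWithin_comp_right` on the open preimage,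
`iteratedFDeriv_comp_add_right`). [cite: HormanderALPDO1, §1.1 Thm. 1.1.7] -/
theorem norm_iteratedFDeriv_comp_clm_add_le {f : Y → E} {s : Set Y} (hs : IsOpen s) (hf : ContDiffOn ℝ ∞ f s) (A : X →L[ℝ] Y) (a : Y) {x : X} (hx : A x + a ∈ s) (n : ℕ) :
    ‖iteratedFDeriv ℝ n (fun y => f (A y + a)) x‖ ≤ ‖A‖ ^ n * ‖iteratedFDeriv ℝ n f (A x + a)‖ := by
  -- shift first: `fa z = f (z + a)` is `C^∞` on the open `(· + a) ⁻¹' s`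
  have hs' : IsOpen ((fun z => z + a) ⁻¹' s) := hs.preimage (continuous_id.add continuous_const)
  have hfa : ContDiffOn ℝ ∞ (fun z => f (z + a)) ((fun z => z + a) ⁻¹' s) := hf.comp (contDiff_id.add contDiff_const).contDiffOn fun z hz => hz
  have hxs : A x ∈ (fun z => z + a) ⁻¹' s := hx
  have hpre : IsOpen (A ⁻¹' ((fun z => z + a) ⁻¹' s)) := hs'.preimage A.continuous
  have key := ContinuousLinearMap.iteratedFDerivWithin_comp_right (i := n) A hfa hs'.uniqueDiffOn hpre.uniqueDiffOn hxs (by exact_mod_cast le_top)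
  rw [iteratedFDerivWithin_of_isOpen n hpre hxs, iteratedFDerivWithin_of_isOpen n hs' hxs] at key
  have hcomp : (fun y => f (A y + a)) = (fun z => f (z + a)) ∘ A := rfl
  rw [hcomp, key, ← iteratedFDeriv_comp_add_right n a (A x)]
  refine (ContinuousMultilinearMap.norm_compContinuousLinearMap_le _ _).trans ?_
  rw [Finset.prod_const, Finset.card_univ, Fintype.card_fin, mul_comm]

/-- **Jets of a continuous linear push-forward**: for `f` `C^∞` on the open `s ∋ x` and `ℓ : E →L F`, `‖iteratedFDeriv ℝ n (fun y => ℓ (f y)) x‖ ≤ ‖ℓ‖ · ‖iteratedFDeriv ℝ n f x‖`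
(Mathlib `ContinuousLinearMap.iteratedFDerivWithin_comp_left`). [cite: HormanderALPDO1, §1.1 Thm. 1.1.7] -/
theorem norm_iteratedFDeriv_clm_apply_le {f : X → E} {s : Set X} (hs : IsOpen s) (hf : ContDiffOn ℝ ∞ f s) (ℓ : E →L[ℝ] F) {x : X} (hx : x ∈ s) (n : ℕ) :
    ‖iteratedFDeriv ℝ n (fun y => ℓ (f y)) x‖ ≤ ‖ℓ‖ * ‖iteratedFDeriv ℝ n f x‖ := by
  have key := ContinuousLinearMap.iteratedFDerivWithin_comp_left (i := n) ℓ (hf x hx) hs.uniqueDiffOn hx (by exact_mod_cast le_top)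
  rw [iteratedFDerivWithin_of_isOpen n hs hx, iteratedFDerivWithin_of_isOpen n hs hx] at key
  have hcomp : (fun y => ℓ (f y)) = ℓ ∘ f := rfl
  rw [hcomp, key]
  exact ContinuousLinearMap.norm_compContinuousMultilinearMap_le _ _

/-- **Leibniz bound on an open set** (Mathlib `norm_iteratedFDerivWithin_mul_le`, read with `iteratedFDeriv` on the open `s`): for `u, v : X → ℂ` `C^∞` on the open `s ∋ x`,
`‖Dⁿ(u·v)(x)‖ ≤ Σ_{i ≤ n} C(n,i) ‖Dⁱu(x)‖ ‖Dⁿ⁻ⁱv(x)‖`. [cite: HormanderALPDO1, §1.1 (1.1.8)] -/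
theorem norm_iteratedFDeriv_mul_le_of_isOpen {u v : X → ℂ} {s : Set X} (hs : IsOpen s) (hu : ContDiffOn ℝ ∞ u s) (hv : ContDiffOn ℝ ∞ v s) {x : X} (hx : x ∈ s) (n : ℕ) :
    ‖iteratedFDeriv ℝ n (fun y => u y * v y) x‖ ≤ ∑ i ∈ Finset.range (n + 1), (n.choose i : ℝ) * ‖iteratedFDeriv ℝ i u x‖ * ‖iteratedFDeriv ℝ (n - i) v x‖ := by
  have key := norm_iteratedFDerivWithin_mul_le (n := n) hu hv hs.uniqueDiffOn hx (by exact_mod_cast le_top)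
  rw [iteratedFDerivWithin_of_isOpen n hs hx] at key
  refine key.trans (le_of_eq (Finset.sum_congr rfl fun i _ => ?_))
  rw [iteratedFDerivWithin_of_isOpen i hs hx, iteratedFDerivWithin_of_isOpen (n - i) hs hx]

/-- Jets of a function `C^∞` on the open `s` agree with those of any function equal to it on `s`. [cite: HormanderALPDO1, §1.1 Thm. 1.1.9] -/
theorem iteratedFDeriv_eq_of_eqOn_isOpen {f g : X → E} {s : Set X} (hs : IsOpen s) (h : EqOn f g s) {x : X} (hx : x ∈ s) (n : ℕ) :
    iteratedFDeriv ℝ n f x = iteratedFDeriv ℝ n g x := by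
  have heq : f =ᶠ[𝓝 x] g := Filter.eventuallyEq_of_mem (hs.mem_nhds hx) h
  exact (heq.iteratedFDeriv ℝ n).eq_of_nhds

end Generic

/-! ## §2 The normalising factor near a wall set: `E_S = u · ∏_{P₀} 2 sin ψ_i`, `u` smooth -/

section Unit

variable {W : Type*} [Fintype W] [DecidableEq W]

/-- **`E_S(c) = u(c) · ∏_{i ∈ P₀} 2 sin ψ_i(c)`** for `P₀ ⊆ Sᶜ`, `ψ_w(c) = (c_w0 − c_w2)/2 − m_wπ`, with `u(c) = (∏_{w∈P₀} i e^{−iψ_w(c)}) · ∏_{w∉P₀} [w ∈ S ? e^{c_w0} : 1 − e^{i(c_w2−c_w0)}]`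
(★ `one_sub_circleExp_eq_two_sin_mul` at the places of `P₀`). [cite: Varadarajan1989, §6.4 Lemma 21] [cite: Shelstad1979, §4 p. 22] -/
theorem expFactor_eq_wallUnit_mul_prod_sin (S P₀ : Finset W) (hP₀ : ∀ w ∈ P₀, w ∉ S) (m : W → ℤ) (c : W → Fin 3 → ℝ) :
    (∏ w, (if w ∈ S then ((Real.exp (c w 0) : ℝ) : ℂ) else 1 - (Circle.exp (c w 2 - c w 0) : ℂ))) =
      ((∏ w ∈ P₀, I * Complex.exp (-((((c w 0 - c w 2) / 2 - m w * Real.pi : ℝ) : ℂ)) * I)) *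
        ∏ w ∈ P₀ᶜ, (if w ∈ S then ((Real.exp (c w 0) : ℝ) : ℂ) else 1 - (Circle.exp (c w 2 - c w 0) : ℂ))) *
      (((∏ i : ↥P₀, 2 * Real.sin ((c i.1 0 - c i.1 2) / 2 - m i.1 * Real.pi)) : ℝ) : ℂ) := by
  rw [← Finset.prod_mul_prod_compl P₀, Complex.ofReal_prod, ← Finset.prod_coe_sort P₀]
  have h1 : ∀ i : ↥P₀, (if i.1 ∈ S then ((Real.exp (c i.1 0) : ℝ) : ℂ) else 1 - (Circle.exp (c i.1 2 - c i.1 0) : ℂ)) =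
      (((2 * Real.sin ((c i.1 0 - c i.1 2) / 2 - m i.1 * Real.pi) : ℝ)) : ℂ) * (I * Complex.exp (-((((c i.1 0 - c i.1 2) / 2 - m i.1 * Real.pi : ℝ) : ℂ)) * I)) := by
    intro i
    rw [if_neg (hP₀ i.1 i.2)]
    exact one_sub_circleExp_eq_two_sin_mul (c i.1 0) (c i.1 2) (m i.1)
  rw [Finset.prod_congr rfl fun i _ => h1 i, Finset.prod_mul_distrib, ← Finset.prod_coe_sort P₀ fun w => I * Complex.exp (-((((c w 0 - c w 2) / 2 - m w * Real.pi : ℝ) : ℂ)) * I)]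
  ring

/-- **The unit `u` is `C^∞` in the coordinates.** [cite: Shelstad1979, §4 p. 22] -/
theorem contDiff_wallUnit (S P₀ : Finset W) (m : W → ℤ) :
    ContDiff ℝ ∞ fun c : W → Fin 3 → ℝ => (∏ w ∈ P₀, I * Complex.exp (-((((c w 0 - c w 2) / 2 - m w * Real.pi : ℝ) : ℂ)) * I)) *
      ∏ w ∈ P₀ᶜ, (if w ∈ S then ((Real.exp (c w 0) : ℝ) : ℂ) else 1 - (Circle.exp (c w 2 - c w 0) : ℂ)) := by
  refine (contDiff_prod fun w _ => contDiff_const.mul (Complex.contDiff_exp.comp ((ofRealCLM.contDiff.comp ?_).neg.mul contDiff_const))).mul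
    (contDiff_prod fun w _ => ?_)
  · exact (((contDiff_apply_apply ℝ ℝ w 0).sub (contDiff_apply_apply ℝ ℝ w 2)).div_const 2).sub contDiff_const
  · by_cases hw : w ∈ S
    · simp only [if_pos hw]
      exact ofRealCLM.contDiff.comp (Real.contDiff_exp.comp (contDiff_apply_apply ℝ ℝ w 0))
    · simp only [if_neg hw]
      have he : ContDiff ℝ ∞ fun c : W → Fin 3 → ℝ => (Circle.exp (c w 2 - c w 0) : ℂ) := by
        have h : (fun c : W → Fin 3 → ℝ => (Circle.exp (c w 2 - c w 0) : ℂ)) = fun c => Complex.exp (((c w 2 - c w 0 : ℝ) : ℂ) * I) :=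
          funext fun c => by rw [Circle.coe_exp]
        rw [h]
        exact Complex.contDiff_exp.comp ((ofRealCLM.contDiff.comp ((contDiff_apply_apply ℝ ℝ w 2).sub (contDiff_apply_apply ℝ ℝ w 0))).mul contDiff_const)
      exact contDiff_const.sub he

end Unit

/-! ## §3 THE LOCAL JET BOUND OF `E_S · I` AT A BASE POINT, MODULO THE `k`-FOLD ENGINE -/

section Local

variable (L : Type) [Field L] [NumberField L] [IsCMField L] (S : Finset {w : InfinitePlace L // IsComplex w})
  [∀ w : {w : InfinitePlace L // IsComplex w}, MeasurableSpace ↥(archLocal L 2 Φ₂[L] w)]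
  [∀ w : {w : InfinitePlace L // IsComplex w}, BorelSpace ↥(archLocal L 2 Φ₂[L] w)]

set_option maxHeartbeats 800000 in
/-- **THE LOCAL JET BOUND OF `G₀ = E_S · I` AT ANY BASE POINT, CONDITIONAL ON THE `k`-FOLD ENGINE.**  Leaves as in ★ `exists_wallSet_representation`; `hInv` = the conclusion of LH10-p01's
`Inv ι` ((α4-S6), frozen text v4) for every wall set `P₀` (at `ι := ↥P₀`, `wl := Subtype.val`, centre `1`, `ν := ν_w|P₀`).  Then for every `c₁` and `n`:
`∃ U ∈ 𝓝 c₁, ∃ B, ∀ c ∈ U ∩ InRegS S, ‖iteratedFDeriv ℝ n (E_S · I) c‖ ≤ B`. [cite: Varadarajan1989, §6.4 Thms 22–23] [cite: Bouaziz1994IntegralesOrbitales, §3.1 (I₂) p. 579]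
[cite: Shelstad1979, §4 pp. 22–25] [cite: HormanderALPDO1, §1.1 Thms. 1.1.6–1.1.9] [cite: Rogawski1990, §8.2 p. 122] -/
theorem exists_nhds_forall_norm_iteratedFDeriv_expFactor_mul_le {fH : 𝔸[L] × 𝔹[L] → ℂ} (hfc : HasCompactSupport fH)
    {Θ : Matrix (Fin 3) (Fin 3) (mixedSpace L) → ℂ} (hΘ : ContDiff ℝ ∞ Θ)
    (hΘf : ∀ k, fH k = Θ (((endoEmbArch L k).val : GL (Fin 3) (mixedSpace L)) : Matrix (Fin 3) (Fin 3) (mixedSpace L)))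
    (νw : ∀ w : {w : InfinitePlace L // IsComplex w}, Measure ↥(archLocal L 2 Φ₂[L] w)) [∀ w, (νw w).IsHaarMeasure]
    (Λw : ∀ w : {w : InfinitePlace L // IsComplex w}, Measure (↥(archLocal L 2 Φ₂[L] w) × ↥(archLocal L 2 Φ₂[L] w))) [∀ w, IsFiniteMeasureOnCompacts (Λw w)]
    [∀ w, SigmaFinite (Λw w)]
    (Zw : ∀ w : {w : InfinitePlace L // IsComplex w}, Set (↥(archLocal L 2 Φ₂[L] w) × ↥(archLocal L 2 Φ₂[L] w))) (hZcl : ∀ w, IsClosed (Zw w)) (hZnull : ∀ w, Λw w (Zw w)ᶜ = 0)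
    (hexpl : ∀ w, w ∉ S → Λw w = Measure.map (fun g : ↥(archLocal L 2 Φ₂[L] w) => (g, (1 : ↥(archLocal L 2 Φ₂[L] w)))) (νw w))
    (hprop : ∀ (w) (U : Set ({w : InfinitePlace L // IsComplex w} → Fin 3 → ℝ)), IsCompact U → (w ∉ S → ∀ c ∈ U, Circle.exp (c w 0) ≠ Circle.exp (c w 2)) →
      ∀ C' : Set ↥(archLocal L 2 Φ₂[L] w), IsCompact C' →
        ∃ 𝒮 : Set (↥(archLocal L 2 Φ₂[L] w) × ↥(archLocal L 2 Φ₂[L] w)), IsCompact 𝒮 ∧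
          ∀ z ∈ Zw w, ∀ c ∈ U, z.1 * (endoBlockAt L S w (c w) * z.2) * z.1⁻¹ ∈ C' → z ∈ 𝒮)
    (hInv : ∀ P₀ : Finset {w : InfinitePlace L // IsComplex w},
      ∀ (V : Type) [NormedAddCommGroup V] [NormedSpace ℝ V] [FiniteDimensional ℝ V]
        (E : Type) [NormedAddCommGroup E] [NormedSpace ℝ E] [CompleteSpace E]
        (Φ : V × (↥P₀ → Matrix (Fin 2) (Fin 2) ℂ) → E) (_ : ContDiff ℝ ∞ Φ)
        (KV : Set V) (_ : IsCompact KV) (K : Set (↥P₀ → Matrix (Fin 2) (Fin 2) ℂ)) (_ : IsCompact K)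
        (_ : ∀ (v : V) (Y : ↥P₀ → Matrix (Fin 2) (Fin 2) ℂ), Y ∉ K → Φ (v, Y) = 0) (n : ℕ) (ε : ↥P₀ → Bool),
        ∃ B : ℝ, ∀ ψ : ↥P₀ → ℝ, (∀ i, 0 < (if ε i then ψ i else -ψ i) ∧ (if ε i then ψ i else -ψ i) < 1) → ∀ v ∈ KV,
          ‖iteratedFDeriv ℝ n (fun x : (↥P₀ → ℝ) × V => (∏ i, 2 * Real.sin (x.1 i)) •
              ∫ h : (∀ i : ↥P₀, ↥(archLocal L 2 Φ₂[L] i.1)),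
                Φ (x.2, fun i => (((h i * ⟨Matrix.GeneralLinearGroup.mkOfDetNeZero !![(1 : ℂ), 1; 1, -1] det_cayleyTwo_ne_zero *
                        circleDiagonal 2 ![1 * Circle.exp (x.1 i), 1 * Circle.exp (-(x.1 i))] *
                        (Matrix.GeneralLinearGroup.mkOfDetNeZero !![(1 : ℂ), 1; 1, -1] det_cayleyTwo_ne_zero)⁻¹,
                      cayley_conj_circleDiagonal_mem_archLocal L i.1 _⟩ * (h i)⁻¹ :
                    ↥(archLocal L 2 Φ₂[L] i.1)) : GL (Fin 2) ℂ) : Matrix (Fin 2) (Fin 2) ℂ)) ∂(Measure.pi fun i : ↥P₀ => νw i.1)) (ψ, v)‖ ≤ B)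
    (c₁ : {w : InfinitePlace L // IsComplex w} → Fin 3 → ℝ) (n : ℕ) :
    ∃ U ∈ 𝓝 c₁, ∃ B : ℝ, ∀ c ∈ U ∩ InRegS S,
      ‖iteratedFDeriv ℝ n (fun c : {w : InfinitePlace L // IsComplex w} → Fin 3 → ℝ =>
        (∏ w, (if w ∈ S then ((Real.exp (c w 0) : ℝ) : ℂ) else 1 - (Circle.exp (c w 2 - c w 0) : ℂ))) *
          ∫ z : ∀ w : {w : InfinitePlace L // IsComplex w}, ↥(archLocal L 2 Φ₂[L] w) × ↥(archLocal L 2 Φ₂[L] w),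
            fH ((archPiEquivCM 2 L Φ₂[L]).symm (fun w => (z w).1 * (endoBlockAt L S w (c w) * (z w).2) * (z w).1⁻¹), (endoTorus L S c).2) ∂(Measure.pi Λw)) c‖ ≤ B := by
  haveI : ∀ w : {w : InfinitePlace L // IsComplex w}, LocallyCompactSpace ↥(archLocal L 2 Φ₂[L] w) := fun w => locallyCompactSpace_archLocal_two L w
  haveI : ∀ w : {w : InfinitePlace L // IsComplex w}, SecondCountableTopology ↥(archLocal L 2 Φ₂[L] w) := fun w => secondCountableTopology_archLocal_two L w
  -- (0) the compact walls through `c₁` and the slab shifts with `ψ_w(c₁) = 0`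
  set P₀ : Finset {w : InfinitePlace L // IsComplex w} := Finset.univ.filter (fun w => w ∉ S ∧ Circle.exp (c₁ w 0) = Circle.exp (c₁ w 2)) with hP₀_def
  have hP₀S : ∀ w ∈ P₀, w ∉ S := fun w hw => (Finset.mem_filter.1 hw).2.1
  have hP₀eq : ∀ w ∈ P₀, Circle.exp (c₁ w 0) = Circle.exp (c₁ w 2) := fun w hw => (Finset.mem_filter.1 hw).2.2
  have hmex : ∀ w : {w : InfinitePlace L // IsComplex w}, ∃ mw : ℤ, w ∈ P₀ → c₁ w 0 = c₁ w 2 + mw * (2 * Real.pi) := by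
    intro w
    by_cases hw : w ∈ P₀
    · obtain ⟨mw, h⟩ := Circle.exp_eq_exp.1 (hP₀eq w hw)
      exact ⟨mw, fun _ => h⟩
    · exact ⟨0, fun h => absurd h hw⟩
  choose m hm using hmex
  have hψ₁ : ∀ i : ↥P₀, (c₁ i.1 0 - c₁ i.1 2) / 2 - m i.1 * Real.pi = 0 := fun i => by rw [hm i.1 i.2]; ring
  -- (1) the neighbourhood: regular at the compact places off `P₀`, and `|ψ_i| < 1`
  have hO₁ : IsOpen {c : {w : InfinitePlace L // IsComplex w} → Fin 3 → ℝ | ∀ w, w ∉ S → w ∉ P₀ → Circle.exp (c w 0) ≠ Circle.exp (c w 2)} := by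
    have h : {c : {w : InfinitePlace L // IsComplex w} → Fin 3 → ℝ | ∀ w, w ∉ S → w ∉ P₀ → Circle.exp (c w 0) ≠ Circle.exp (c w 2)} =
        ⋂ w, {c | w ∉ S → w ∉ P₀ → Circle.exp (c w 0) ≠ Circle.exp (c w 2)} := by ext c; simp
    rw [h]
    refine isOpen_iInter_of_finite fun w => ?_
    by_cases hwS : w ∈ S
    · have : {c : {w : InfinitePlace L // IsComplex w} → Fin 3 → ℝ | w ∉ S → w ∉ P₀ → Circle.exp (c w 0) ≠ Circle.exp (c w 2)} = univ :=
        Set.eq_univ_of_forall fun c h => absurd hwS h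
      rw [this]; exact isOpen_univ
    by_cases hwP : w ∈ P₀
    · have : {c : {w : InfinitePlace L // IsComplex w} → Fin 3 → ℝ | w ∉ S → w ∉ P₀ → Circle.exp (c w 0) ≠ Circle.exp (c w 2)} = univ :=
        Set.eq_univ_of_forall fun c _ h => absurd hwP h
      rw [this]; exact isOpen_univ
    · have : {c : {w : InfinitePlace L // IsComplex w} → Fin 3 → ℝ | w ∉ S → w ∉ P₀ → Circle.exp (c w 0) ≠ Circle.exp (c w 2)} =
          {c | Circle.exp (c w 0) ≠ Circle.exp (c w 2)} := by
        ext c; simp only [Set.mem_setOf_eq]; exact ⟨fun h => h hwS hwP, fun h _ _ => h⟩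
      rw [this]
      exact isOpen_ne_fun (Circle.exp.continuous.comp ((continuous_apply 0).comp (continuous_apply w)))
        (Circle.exp.continuous.comp ((continuous_apply 2).comp (continuous_apply w)))
  have hc₁O₁ : c₁ ∈ {c : {w : InfinitePlace L // IsComplex w} → Fin 3 → ℝ | ∀ w, w ∉ S → w ∉ P₀ → Circle.exp (c w 0) ≠ Circle.exp (c w 2)} := by
    intro w hwS hwP h
    exact hwP (Finset.mem_filter.2 ⟨Finset.mem_univ _, hwS, h⟩)
  have hO₂ : IsOpen {c : {w : InfinitePlace L // IsComplex w} → Fin 3 → ℝ | ∀ i : ↥P₀, |(c i.1 0 - c i.1 2) / 2 - m i.1 * Real.pi| < 1} := by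
    have h : {c : {w : InfinitePlace L // IsComplex w} → Fin 3 → ℝ | ∀ i : ↥P₀, |(c i.1 0 - c i.1 2) / 2 - m i.1 * Real.pi| < 1} =
        ⋂ i : ↥P₀, (fun c : {w : InfinitePlace L // IsComplex w} → Fin 3 → ℝ => |(c i.1 0 - c i.1 2) / 2 - m i.1 * Real.pi|) ⁻¹' Iio 1 := by ext c; simp
    rw [h]
    refine isOpen_iInter_of_finite fun i => IsOpen.preimage ?_ isOpen_Iio
    have h0 : Continuous fun c : {w : InfinitePlace L // IsComplex w} → Fin 3 → ℝ => c i.1 0 := continuous_apply_apply i.1 0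
    have h2 : Continuous fun c : {w : InfinitePlace L // IsComplex w} → Fin 3 → ℝ => c i.1 2 := continuous_apply_apply i.1 2
    exact (((h0.sub h2).div_const 2).sub continuous_const).abs
  have hc₁O₂ : c₁ ∈ {c : {w : InfinitePlace L // IsComplex w} → Fin 3 → ℝ | ∀ i : ↥P₀, |(c i.1 0 - c i.1 2) / 2 - m i.1 * Real.pi| < 1} := by
    intro i; rw [hψ₁ i, abs_zero]; exact one_pos
  obtain ⟨r, hr, hball⟩ := Metric.isOpen_iff.1 (hO₁.inter hO₂) c₁ ⟨hc₁O₁, hc₁O₂⟩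
  have hC₁sub : Metric.closedBall c₁ (r / 2) ⊆ _ := (Metric.closedBall_subset_ball (half_lt_self hr)).trans hball
  have hC₁ : IsCompact (Metric.closedBall c₁ (r / 2)) := isCompact_closedBall _ _
  -- (2) the wall-set representation over `C₁ = closedBall c₁ (r/2)`
  obtain ⟨𝒮, K, g, ℓ, h𝒮c, hKc, hg, hg0, hrep⟩ := exists_wallSet_representation L S hfc hΘ hΘf νw Λw Zw hZcl hZnull hexpl hprop P₀ hP₀S m hC₁
    (fun c hc w hwS hwP => (hC₁sub hc).1 w hwS hwP)
  -- (3) the engine's joint functional `F` for `Φ := g`, its bounds at all orders, its smoothness off the walls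
  set F : (↥P₀ → ℝ) × ({w : InfinitePlace L // IsComplex w} → Fin 3 → ℝ) → (↥𝒮 →ᵇ ℂ) := fun x => (∏ i, 2 * Real.sin (x.1 i)) •
    ∫ h : (∀ i : ↥P₀, ↥(archLocal L 2 Φ₂[L] i.1)),
      g (x.2, fun i => (((h i * ⟨Matrix.GeneralLinearGroup.mkOfDetNeZero !![(1 : ℂ), 1; 1, -1] det_cayleyTwo_ne_zero *
              circleDiagonal 2 ![1 * Circle.exp (x.1 i), 1 * Circle.exp (-(x.1 i))] *
              (Matrix.GeneralLinearGroup.mkOfDetNeZero !![(1 : ℂ), 1; 1, -1] det_cayleyTwo_ne_zero)⁻¹,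
            cayley_conj_circleDiagonal_mem_archLocal L i.1 _⟩ * (h i)⁻¹ : ↥(archLocal L 2 Φ₂[L] i.1)) : GL (Fin 2) ℂ) : Matrix (Fin 2) (Fin 2) ℂ))
        ∂(Measure.pi fun i : ↥P₀ => νw i.1) with hF_def
  have hB : ∀ k : ℕ, ∃ B : ℝ, ∀ ψ : ↥P₀ → ℝ, (∀ i, 0 < |ψ i| ∧ |ψ i| < 1) → ∀ v ∈ Metric.closedBall c₁ (r / 2), ‖iteratedFDeriv ℝ k F (ψ, v)‖ ≤ B := by
    intro k
    choose Bε hBε using fun ε : ↥P₀ → Bool =>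
      hInv P₀ ({w : InfinitePlace L // IsComplex w} → Fin 3 → ℝ) (↥𝒮 →ᵇ ℂ) g hg (Metric.closedBall c₁ (r / 2)) hC₁ K hKc hg0 k ε
    refine ⟨Finset.univ.sup' Finset.univ_nonempty Bε, fun ψ hψ v hv => ?_⟩
    set ε : ↥P₀ → Bool := fun i => decide (0 < ψ i) with hε
    have hψε : ∀ i, 0 < (if ε i then ψ i else -ψ i) ∧ (if ε i then ψ i else -ψ i) < 1 := by
      intro i
      obtain ⟨h0, h1⟩ := hψ i
      by_cases hp : 0 < ψ i
      · have : ε i = true := by simp [hε, hp]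
        simp only [this, ↓reduceIte]
        rw [← abs_of_pos hp]
        exact ⟨h0, h1⟩
      · have : ε i = false := by simp [hε, hp]
        have hneg : ψ i < 0 := lt_of_le_of_ne (not_lt.1 hp) (fun h => (abs_pos.1 h0) h)
        simp only [this, Bool.false_eq_true, ↓reduceIte]
        rw [← abs_of_neg hneg]
        exact ⟨h0, h1⟩
    have h := hBε ε ψ hψε v hv
    rw [hF_def]
    exact h.trans (Finset.le_sup' Bε (Finset.mem_univ ε))
  choose Bk hBk using hB
  have hUF : IsOpen {x : (↥P₀ → ℝ) × ({w : InfinitePlace L // IsComplex w} → Fin 3 → ℝ) | ∀ i, Real.sin (x.1 i) ≠ 0} := by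
    have h : {x : (↥P₀ → ℝ) × ({w : InfinitePlace L // IsComplex w} → Fin 3 → ℝ) | ∀ i, Real.sin (x.1 i) ≠ 0} =
        ⋂ i, (fun x : (↥P₀ → ℝ) × ({w : InfinitePlace L // IsComplex w} → Fin 3 → ℝ) => Real.sin (x.1 i)) ⁻¹' {0}ᶜ := by ext x; simp
    rw [h]
    exact isOpen_iInter_of_finite fun i => (Real.continuous_sin.comp ((continuous_apply i).comp continuous_fst)).isOpen_preimage _ isOpen_compl_singleton
  have hFs : ContDiffOn ℝ ∞ F {x | ∀ i, Real.sin (x.1 i) ≠ 0} := by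
    rw [hF_def]
    exact contDiffOn_torusFunctional L (fun i : ↥P₀ => i.1) (fun i => νw i.1)
      (fun i ψ => ⟨Matrix.GeneralLinearGroup.mkOfDetNeZero !![(1 : ℂ), 1; 1, -1] det_cayleyTwo_ne_zero * circleDiagonal 2 ![1 * Circle.exp ψ, 1 * Circle.exp (-ψ)] *
        (Matrix.GeneralLinearGroup.mkOfDetNeZero !![(1 : ℂ), 1; 1, -1] det_cayleyTwo_ne_zero)⁻¹, cayley_conj_circleDiagonal_mem_archLocal L i.1 _⟩)
      (fun i => contDiff_coe_cayleyTorus L i.1 1) (fun i Kψ hKψ hreg C hC => exists_isCompact_forall_conj_cayleyTorus_mem_imp_mem L i.1 1 hKψ hreg hC)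
      hKc hg hg0 (fun ψ d => rfl)
  -- (4) the unit `u` and the affine map `J c = Jl c + J₀ = (ψ(c), c)`
  have hu := contDiff_wallUnit S P₀ m
  let Lψl : ({w : InfinitePlace L // IsComplex w} → Fin 3 → ℝ) →ₗ[ℝ] (↥P₀ → ℝ) :=
    { toFun := fun c i => (c i.1 0 - c i.1 2) / 2
      map_add' := fun c c' => by funext i; simp only [Pi.add_apply]; ring
      map_smul' := fun a c => by funext i; simp only [Pi.smul_apply, smul_eq_mul, RingHom.id_apply]; ring }
  let Jl : ({w : InfinitePlace L // IsComplex w} → Fin 3 → ℝ) →L[ℝ] ((↥P₀ → ℝ) × ({w : InfinitePlace L // IsComplex w} → Fin 3 → ℝ)) :=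
    (LinearMap.toContinuousLinearMap Lψl).prod (ContinuousLinearMap.id ℝ _)
  let J₀ : (↥P₀ → ℝ) × ({w : InfinitePlace L // IsComplex w} → Fin 3 → ℝ) := (fun i => -((m i.1 : ℝ) * Real.pi), 0)
  have hJ : ∀ c, Jl c + J₀ = (fun i : ↥P₀ => (c i.1 0 - c i.1 2) / 2 - m i.1 * Real.pi, c) := by
    intro c
    refine Prod.ext (funext fun i => ?_) ?_
    · show (c i.1 0 - c i.1 2) / 2 + -((m i.1 : ℝ) * Real.pi) = (c i.1 0 - c i.1 2) / 2 - m i.1 * Real.pi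
      ring
    · show c + 0 = c
      exact add_zero c
  -- (5) the identity `E_S · I = u · ℓ(F(J c))` on the open `O = ball c₁ (r/2) ∩ InRegS S`
  have hO : IsOpen (Metric.ball c₁ (r / 2) ∩ InRegS S) := Metric.isOpen_ball.inter (isOpen_inRegS S)
  have hEq : EqOn (fun c : {w : InfinitePlace L // IsComplex w} → Fin 3 → ℝ =>
        (∏ w, (if w ∈ S then ((Real.exp (c w 0) : ℝ) : ℂ) else 1 - (Circle.exp (c w 2 - c w 0) : ℂ))) *
          ∫ z : ∀ w : {w : InfinitePlace L // IsComplex w}, ↥(archLocal L 2 Φ₂[L] w) × ↥(archLocal L 2 Φ₂[L] w),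
            fH ((archPiEquivCM 2 L Φ₂[L]).symm (fun w => (z w).1 * (endoBlockAt L S w (c w) * (z w).2) * (z w).1⁻¹), (endoTorus L S c).2) ∂(Measure.pi Λw))
      (fun c => ((∏ w ∈ P₀, I * Complex.exp (-((((c w 0 - c w 2) / 2 - m w * Real.pi : ℝ) : ℂ)) * I)) *
        ∏ w ∈ P₀ᶜ, (if w ∈ S then ((Real.exp (c w 0) : ℝ) : ℂ) else 1 - (Circle.exp (c w 2 - c w 0) : ℂ))) * ℓ (F (Jl c + J₀)))
      (Metric.ball c₁ (r / 2) ∩ InRegS S) := by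
    intro c hc
    have hcC : c ∈ Metric.closedBall c₁ (r / 2) := Metric.ball_subset_closedBall hc.1
    simp only
    rw [hrep c ⟨hcC, hc.2⟩, expFactor_eq_wallUnit_mul_prod_sin S P₀ hP₀S m c, hJ c, hF_def]
    simp only
    rw [ℓ.map_smul, Complex.real_smul, mul_assoc]
  -- (6) bounds for the jets of `u` on `C₁`
  have hUb : ∀ i : ℕ, ∃ Ui : ℝ, ∀ c ∈ Metric.closedBall c₁ (r / 2), ‖iteratedFDeriv ℝ i (fun c : {w : InfinitePlace L // IsComplex w} → Fin 3 → ℝ =>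
      (∏ w ∈ P₀, I * Complex.exp (-((((c w 0 - c w 2) / 2 - m w * Real.pi : ℝ) : ℂ)) * I)) *
        ∏ w ∈ P₀ᶜ, (if w ∈ S then ((Real.exp (c w 0) : ℝ) : ℂ) else 1 - (Circle.exp (c w 2 - c w 0) : ℂ))) c‖ ≤ Ui := fun i =>
    hC₁.exists_bound_of_continuousOn ((hu.continuous_iteratedFDeriv (by exact_mod_cast le_top)).continuousOn)
  choose Ub hUb using hUb
  -- (7) the bound
  refine ⟨Metric.ball c₁ (r / 2), Metric.ball_mem_nhds _ (half_pos hr),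
    ∑ i ∈ Finset.range (n + 1), (n.choose i : ℝ) * Ub i * (‖ℓ‖ * (‖Jl‖ ^ (n - i) * Bk (n - i))), fun c hc => ?_⟩
  have hcC : c ∈ Metric.closedBall c₁ (r / 2) := Metric.ball_subset_closedBall hc.1
  have hreg : ∀ w, w ∉ S → Circle.exp (c w 0) ≠ Circle.exp (c w 2) := (mem_inRegS_iff S c).1 hc.2
  -- `J c` lies off the walls, in the open signed unit cube times `C₁`
  have hsin : ∀ i : ↥P₀, Real.sin ((c i.1 0 - c i.1 2) / 2 - m i.1 * Real.pi) ≠ 0 := fun i => sin_wallAngle_ne_zero_of_circleExp_ne (hreg i.1 (hP₀S i.1 i.2)) (m i.1)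
  have hJU : Jl c + J₀ ∈ {x : (↥P₀ → ℝ) × ({w : InfinitePlace L // IsComplex w} → Fin 3 → ℝ) | ∀ i, Real.sin (x.1 i) ≠ 0} := by
    rw [hJ c]; exact hsin
  have hψc : ∀ i : ↥P₀, 0 < |(c i.1 0 - c i.1 2) / 2 - m i.1 * Real.pi| ∧ |(c i.1 0 - c i.1 2) / 2 - m i.1 * Real.pi| < 1 := fun i =>
    ⟨abs_pos.2 fun h => hsin i (by rw [h, Real.sin_zero]), (hC₁sub hcC).2 i⟩
  -- `F ∘ J` and `ℓ ∘ F ∘ J` are `C^∞` on the open preimage of the off-wall set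
  have hpre : IsOpen ((fun c => Jl c + J₀) ⁻¹' {x : (↥P₀ → ℝ) × ({w : InfinitePlace L // IsComplex w} → Fin 3 → ℝ) | ∀ i, Real.sin (x.1 i) ≠ 0}) :=
    hUF.preimage (Jl.continuous.add continuous_const)
  have hFJ : ContDiffOn ℝ ∞ (fun c => F (Jl c + J₀)) ((fun c => Jl c + J₀) ⁻¹' {x | ∀ i, Real.sin (x.1 i) ≠ 0}) :=
    hFs.comp (Jl.contDiff.add contDiff_const).contDiffOn fun c hc => hc
  have hℓFJ : ContDiffOn ℝ ∞ (fun c => ℓ (F (Jl c + J₀))) (Metric.ball c₁ (r / 2) ∩ InRegS S) :=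
    (ℓ.contDiff.comp_contDiffOn hFJ).mono fun c' hc' => by
      show Jl c' + J₀ ∈ {x : (↥P₀ → ℝ) × ({w : InfinitePlace L // IsComplex w} → Fin 3 → ℝ) | ∀ i, Real.sin (x.1 i) ≠ 0}
      rw [hJ c']
      exact fun i => sin_wallAngle_ne_zero_of_circleExp_ne (((mem_inRegS_iff S c').1 hc'.2) i.1 (hP₀S i.1 i.2)) (m i.1)
  rw [iteratedFDeriv_eq_of_eqOn_isOpen hO hEq hc n]
  refine (norm_iteratedFDeriv_mul_le_of_isOpen hO hu.contDiffOn hℓFJ hc n).trans (Finset.sum_le_sum fun i hi => ?_)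
  have h1 : ‖iteratedFDeriv ℝ (n - i) (fun c => ℓ (F (Jl c + J₀))) c‖ ≤ ‖ℓ‖ * (‖Jl‖ ^ (n - i) * Bk (n - i)) := by
    refine (norm_iteratedFDeriv_clm_apply_le hpre hFJ ℓ hJU (n - i)).trans (mul_le_mul_of_nonneg_left ?_ (norm_nonneg _))
    refine (norm_iteratedFDeriv_comp_clm_add_le hUF hFs Jl J₀ hJU (n - i)).trans (mul_le_mul_of_nonneg_left ?_ (pow_nonneg (norm_nonneg _) _))
    have h := hBk (n - i) (fun i : ↥P₀ => (c i.1 0 - c i.1 2) / 2 - m i.1 * Real.pi) hψc c hcC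
    rwa [← hJ c] at h
  have h2 : ‖iteratedFDeriv ℝ i (fun c : {w : InfinitePlace L // IsComplex w} → Fin 3 → ℝ =>
      (∏ w ∈ P₀, I * Complex.exp (-((((c w 0 - c w 2) / 2 - m w * Real.pi : ℝ) : ℂ)) * I)) *
        ∏ w ∈ P₀ᶜ, (if w ∈ S then ((Real.exp (c w 0) : ℝ) : ℂ) else 1 - (Circle.exp (c w 2 - c w 0) : ℂ))) c‖ ≤ Ub i := hUb i c hcC
  have hU0 : 0 ≤ Ub i := (norm_nonneg _).trans h2
  calc (n.choose i : ℝ) * ‖iteratedFDeriv ℝ i (fun c : {w : InfinitePlace L // IsComplex w} → Fin 3 → ℝ =>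
          (∏ w ∈ P₀, I * Complex.exp (-((((c w 0 - c w 2) / 2 - m w * Real.pi : ℝ) : ℂ)) * I)) *
            ∏ w ∈ P₀ᶜ, (if w ∈ S then ((Real.exp (c w 0) : ℝ) : ℂ) else 1 - (Circle.exp (c w 2 - c w 0) : ℂ))) c‖ *
          ‖iteratedFDeriv ℝ (n - i) (fun c => ℓ (F (Jl c + J₀))) c‖
      ≤ (n.choose i : ℝ) * Ub i * (‖ℓ‖ * (‖Jl‖ ^ (n - i) * Bk (n - i))) := by
        refine mul_le_mul (mul_le_mul_of_nonneg_left h2 (Nat.cast_nonneg _)) h1 (norm_nonneg _) (mul_nonneg (Nat.cast_nonneg _) hU0)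

end Local

end Literature.NumberTheory.Rogawski1990

end
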